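import Mathlib
import Summits.ValiantsHypothesis.ValiantsHypothesis.Theorems.BarrierLeverPartitionMinorsHitByVPHiddenStatesSecondShellPrescribed
import Summits.ValiantsHypothesis.ValiantsHypothesis.Theorems.BarrierLeverPartitionMinorsHitByVPHiddenStatesSecondShellTwoTops

/-!
# Route BarrierLever — item `PartitionMinorsHitByVP` (stmt-ValiantsHypothesis-19717), line `hidden-states`:
# WHO READS WHOM in a prescribed path table (`k = 2, 3`) — toolkit for the chain cells

Helper file (`--supports stmt-ValiantsHypothesis-19717`; cell valiant-natproofs, 𝒟-side door (c), registered line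
`Cruxes/PartitionMinorsHitByVP/Lines/hidden_states.lean` v8; prover seat val-np-p6 gen 18).  Closes NO item; definition-free.

For a transport with prescribed path positions (`…SecondShellPrescribed.exists_equiv_prescribed`) the chain cells need, node by
node, the list of coordinates a path node reads (its sources) and the zero entries between path nodes.  `k = 2` (path
`y₀ < y₁ < y₂`, attachments `x₀, x₁` at `y₀`): ★ `path₂_reads`, `path₂_zeros`; `k = 3` (path `y₀ < y₁ < y₂ < y₃`, attachments
`x₀, x₁` at `y₀`, `x₂` at `y₁`): ★ `path₃_reads`, `path₃_zeros`.  Pure bookkeeping on `swapTable'_path_row_ne_zero` /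
`swapTable'_path_path`.

HONEST LABEL: conjecture-column toolkit (second shell, every `t, h`); 19717 stays OPEN; nothing on crux 14610 or VP ≠ VNP.
-/

set_option linter.dupNamespace false

namespace Summit.ValiantsHypothesis.ValiantsHypothesis.Theorems.BarrierLever.HiddenStates

open Finset

noncomputable section

namespace SecondShell

open PathTable

variable {α : Type}

/-- ★ sources in a `k = 2` path table with prescribed positions: `y₀` reads `x₀, x₁`; `y₁` reads `y₀`; `y₂` reads `y₁`. -/
theorem path₂_reads {j j' : ℕ} (e : (Fin (2 + 1) ⊕ Fin 2) ⊕ (Fin j ⊕ Fin j') ≃ α) {y₀ y₁ y₂ x₀ x₁ : α}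
    (h0 : e (Sum.inl (Sum.inl 0)) = y₀) (h1 : e (Sum.inl (Sum.inl 1)) = y₁) (h2 : e (Sum.inl (Sum.inl 2)) = y₂)
    (hx0 : e (Sum.inl (Sum.inr 0)) = x₀) (hx1 : e (Sum.inl (Sum.inr 1)) = x₁) (d : α) :
    (swapTable' e y₀ d ≠ 0 → d ≠ y₀ → d = x₀ ∨ d = x₁) ∧ (swapTable' e y₁ d ≠ 0 → d ≠ y₁ → d = y₀) ∧
      (swapTable' e y₂ d ≠ 0 → d ≠ y₂ → d = y₁) := by
  have hsrc : ∀ (p : Fin (2 + 1)), swapTable' e (e (Sum.inl (Sum.inl p))) d ≠ 0 → d ≠ e (Sum.inl (Sum.inl p)) →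
      (∃ p' : Fin (2 + 1), (p' : ℕ) + 1 = p ∧ d = e (Sum.inl (Sum.inl p'))) ∨
        (lvlX 2 0 = p ∧ d = x₀) ∨ (lvlX 2 1 = p ∧ d = x₁) := by
    intro p hd hne
    rcases swapTable'_path_row_ne_zero e p hd hne with h' | ⟨i, hi, rfl⟩
    · exact Or.inl h'
    · right
      fin_cases i
      · exact Or.inl ⟨hi, hx0⟩
      · exact Or.inr ⟨hi, hx1⟩
  refine ⟨fun hd hne => ?_, fun hd hne => ?_, fun hd hne => ?_⟩
  · rw [← h0] at hd hne
    rcases hsrc 0 hd hne with ⟨p', hp', -⟩ | ⟨-, h⟩ | ⟨-, h⟩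
    · exfalso; simp at hp'
    · exact Or.inl h
    · exact Or.inr h
  · rw [← h1] at hd hne
    rcases hsrc 1 hd hne with ⟨p', hp', rfl⟩ | ⟨hl, -⟩ | ⟨hl, -⟩
    · fin_cases p' <;> first | exact h0 | (exfalso; simp at hp')
    · exfalso; simp [lvlX] at hl
    · exfalso; simp [lvlX] at hl
  · rw [← h2] at hd hne
    rcases hsrc 2 hd hne with ⟨p', hp', rfl⟩ | ⟨hl, -⟩ | ⟨hl, -⟩
    · fin_cases p' <;> first | exact h1 | (exfalso; simp at hp')
    · exfalso; simp [lvlX] at hl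
    · exfalso; simp [lvlX] at hl

/-- zero entries between the nodes of a `k = 2` path table (only the node just below is read). -/
theorem path₂_zeros {j j' : ℕ} (e : (Fin (2 + 1) ⊕ Fin 2) ⊕ (Fin j ⊕ Fin j') ≃ α) {y₀ y₁ y₂ : α}
    (h0 : e (Sum.inl (Sum.inl 0)) = y₀) (h1 : e (Sum.inl (Sum.inl 1)) = y₁) (h2 : e (Sum.inl (Sum.inl 2)) = y₂) :
    swapTable' e y₀ y₁ = 0 ∧ swapTable' e y₀ y₂ = 0 ∧ swapTable' e y₁ y₂ = 0 ∧ swapTable' e y₂ y₀ = 0 := by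
  refine ⟨?_, ?_, ?_, ?_⟩
  · rw [← h0, ← h1, swapTable'_path_path]; simp
  · rw [← h0, ← h2, swapTable'_path_path]; simp
  · rw [← h1, ← h2, swapTable'_path_path]; simp
  · rw [← h2, ← h0, swapTable'_path_path]; simp

/-- ★ sources in a `k = 3` path table with prescribed positions: `y₀` reads `x₀, x₁`; `y₁` reads `y₀` and `x₂`; `y₂` reads
`y₁`; `y₃` reads `y₂`. -/
theorem path₃_reads {j j' : ℕ} (e : (Fin (3 + 1) ⊕ Fin 3) ⊕ (Fin j ⊕ Fin j') ≃ α) {y₀ y₁ y₂ y₃ x₀ x₁ x₂ : α}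
    (h0 : e (Sum.inl (Sum.inl 0)) = y₀) (h1 : e (Sum.inl (Sum.inl 1)) = y₁) (h2 : e (Sum.inl (Sum.inl 2)) = y₂)
    (h3 : e (Sum.inl (Sum.inl 3)) = y₃) (hx0 : e (Sum.inl (Sum.inr 0)) = x₀) (hx1 : e (Sum.inl (Sum.inr 1)) = x₁)
    (hx2 : e (Sum.inl (Sum.inr 2)) = x₂) (d : α) :
    (swapTable' e y₀ d ≠ 0 → d ≠ y₀ → d = x₀ ∨ d = x₁) ∧ (swapTable' e y₁ d ≠ 0 → d ≠ y₁ → d = y₀ ∨ d = x₂) ∧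
      (swapTable' e y₂ d ≠ 0 → d ≠ y₂ → d = y₁) ∧ (swapTable' e y₃ d ≠ 0 → d ≠ y₃ → d = y₂) := by
  have hsrc : ∀ (p : Fin (3 + 1)), swapTable' e (e (Sum.inl (Sum.inl p))) d ≠ 0 → d ≠ e (Sum.inl (Sum.inl p)) →
      (∃ p' : Fin (3 + 1), (p' : ℕ) + 1 = p ∧ d = e (Sum.inl (Sum.inl p'))) ∨
        (lvlX 3 0 = p ∧ d = x₀) ∨ (lvlX 3 1 = p ∧ d = x₁) ∨ (lvlX 3 2 = p ∧ d = x₂) := by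
    intro p hd hne
    rcases swapTable'_path_row_ne_zero e p hd hne with h' | ⟨i, hi, rfl⟩
    · exact Or.inl h'
    · right
      fin_cases i
      · exact Or.inl ⟨hi, hx0⟩
      · exact Or.inr (Or.inl ⟨hi, hx1⟩)
      · exact Or.inr (Or.inr ⟨hi, hx2⟩)
  refine ⟨fun hd hne => ?_, fun hd hne => ?_, fun hd hne => ?_, fun hd hne => ?_⟩
  · rw [← h0] at hd hne
    rcases hsrc 0 hd hne with ⟨p', hp', -⟩ | ⟨-, h⟩ | ⟨-, h⟩ | ⟨hl, -⟩
    · exfalso; simp at hp'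
    · exact Or.inl h
    · exact Or.inr h
    · exfalso; simp [lvlX] at hl
  · rw [← h1] at hd hne
    rcases hsrc 1 hd hne with ⟨p', hp', rfl⟩ | ⟨hl, -⟩ | ⟨hl, -⟩ | ⟨-, h⟩
    · left; fin_cases p' <;> first | exact h0 | (exfalso; simp at hp')
    · exfalso; simp [lvlX] at hl
    · exfalso; simp [lvlX] at hl
    · exact Or.inr h
  · rw [← h2] at hd hne
    rcases hsrc 2 hd hne with ⟨p', hp', rfl⟩ | ⟨hl, -⟩ | ⟨hl, -⟩ | ⟨hl, -⟩
    · fin_cases p' <;> first | exact h1 | (exfalso; simp at hp')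
    · exfalso; simp [lvlX] at hl
    · exfalso; simp [lvlX] at hl
    · exfalso; simp [lvlX] at hl
  · rw [← h3] at hd hne
    rcases hsrc 3 hd hne with ⟨p', hp', rfl⟩ | ⟨hl, -⟩ | ⟨hl, -⟩ | ⟨hl, -⟩
    · fin_cases p' <;> first | exact h2 | (exfalso; simp at hp')
    · exfalso; simp [lvlX] at hl
    · exfalso; simp [lvlX] at hl
    · exfalso; simp [lvlX] at hl

/-- zero entries between the nodes of a `k = 3` path table (only the node just below is read). -/
theorem path₃_zeros {j j' : ℕ} (e : (Fin (3 + 1) ⊕ Fin 3) ⊕ (Fin j ⊕ Fin j') ≃ α) {y₀ y₁ y₂ y₃ : α}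
    (h0 : e (Sum.inl (Sum.inl 0)) = y₀) (h1 : e (Sum.inl (Sum.inl 1)) = y₁) (h2 : e (Sum.inl (Sum.inl 2)) = y₂)
    (h3 : e (Sum.inl (Sum.inl 3)) = y₃) :
    swapTable' e y₀ y₁ = 0 ∧ swapTable' e y₀ y₂ = 0 ∧ swapTable' e y₀ y₃ = 0 ∧ swapTable' e y₁ y₂ = 0 ∧
      swapTable' e y₁ y₃ = 0 ∧ swapTable' e y₂ y₀ = 0 ∧ swapTable' e y₂ y₃ = 0 ∧ swapTable' e y₃ y₀ = 0 ∧
      swapTable' e y₃ y₁ = 0 := by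
  refine ⟨?_, ?_, ?_, ?_, ?_, ?_, ?_, ?_, ?_⟩
  · rw [← h0, ← h1, swapTable'_path_path]; simp
  · rw [← h0, ← h2, swapTable'_path_path]; simp
  · rw [← h0, ← h3, swapTable'_path_path]; simp
  · rw [← h1, ← h2, swapTable'_path_path]; simp
  · rw [← h1, ← h3, swapTable'_path_path]; simp
  · rw [← h2, ← h0, swapTable'_path_path]; simp
  · rw [← h2, ← h3, swapTable'_path_path]; simp
  · rw [← h3, ← h0, swapTable'_path_path]; simp
  · rw [← h3, ← h1, swapTable'_path_path]; simp [Fin.ext_iff]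

end SecondShell

end

end Summit.ValiantsHypothesis.ValiantsHypothesis.Theorems.BarrierLever.HiddenStates
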